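import Summits.KontsevichZagierPeriods.Zeta5Search.Barrier.ConeGammaLogCuspSlope

/-!
# ζ(5) search — BARRIER: the SYMMETRIC PART `σ(δ) + σ(−δ)` of the cusp slope — end germs, reflection form, single walls

HONEST FRAMING (cell `pub-zeta5`): systematic search; no irrationality claim unless kernel-certified. MODEL objects
under Brown–Zudilin's (28)+(30) accounting ([BZ22] = arXiv:2210.03391; (28) observed, not proved); nothing here is a
statement about `ζ(5)`, about any `γ` of record, about the cone's supremum (C2 = `BarrierC2` OPEN) or about the SIGN
of any cusp slope or reflection defect at any named direction (those are DATA of the cell, not kernel facts); the lemma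
S-E stays CONJECTURED; records in print UNMOVED. Prover P2 g25 (item (c) of P2 g23's successor list = the lead's
standing word, lit g37 INBOX l.9213, «`cuspSlope` sign structure, desk first»; plan INBOX l.9221).

DESK FIRST (exact rationals, `HOME/pub-zeta5-p2/g25/alg/sympart.py` on P2 g11's `se2.py`): the symmetric part
`σ(δ) + σ(−δ)` (`σ = cuspSlope a T`) has NO FIXED SIGN across directions and displacements (flag/60 along `e₁` and
`t*` along `±w`: `> 0`; record/41, argmax/120, the axes at `t*`: `< 0`). What DOES hold — proved here for the tree's
germ integrals (`ConeGammaShiftGerms`: `germR a δ η b = ∫₀^W D_η(b + ηw) dw`, `germL a δ η b = ∫_{−W}^0 D_η(b + ηw) dw`,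
`D_η(u) = shiftDiff a δ η u = 𝒩(u·s(a) + ηδ) − 𝒩(u·s(a))`, `W = clusterWidth a δ`) — is a three-part STRUCTURE:
* **`germR_zero_nonneg`, `germL_period_nonneg`** — THE LATTICE POINT NEVER PULLS DOWN: at the two ends `b = 0`,
  `b = T` of the period (the torus point `θ = 0`, where all 28 walls meet) the one-sided germs of `σ(δ)` ITSELF are
  `≥ 0` for EVERY displacement `δ` and every scale `η ≥ 0` with `η·K < 1` (`K = clusterBound a δ`): the unperturbed
  saving vanishes on both sides of the lattice point (`torusN_line_eq_zero_of_small`: `|t|·x_max < 1 ⇒ 𝒩(t·s(a)) = 0`,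
  all 28 integer parts `0` or all `−1`, `torusN_eq_zero_of_floor_eq`), so the germ integrand is `𝒩 ≥ 0`.
* **`germ_symm_eq_integral_refl`** + **`shiftDiff_add_shiftDiff_neg_reflect`** — REFLECTION FORM: at any `b`,
  `germR(δ) + germL(δ) + germR(−δ) + germL(−δ) = ∫₀^W [Refl(w·s+δ) + Refl(w·s−δ)] dw`, where for `ζ ∈ ℝ⁸`
  `Refl(ζ) = 𝒩(θ_b + ηζ) + 𝒩(θ_b − ηζ) − 𝒩(θ_b + ηw·s) − 𝒩(θ_b − ηw·s)` (`θ_b = b·s(a)`): the left germ is a right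
  integral of the REFLECTED displacement (`germL_eq_integral_reflect`, `w ↦ −w`), and pairing `germR(δ)` with
  `germL(−δ)` makes the symmetric part the integral of a REFLECTION DEFECT of the step function `𝒩` through `θ_b`.
* **`torusN_single_wall_eq`**, **`refl_eq_of_single_wall`**, **`germ_symm_eq_zero_of_single_wall`** — SINGLE WALLS
  DROP OUT: at a breakpoint `b ∈ bkpts a T` where exactly ONE form `h_{k₀}` takes an integer value, and for
  displacements below the wall distance (`|φ_k(Δ)| < 1`, `< wallDist a T`), `𝒩(θ_b + Δ)` depends on `Δ` only through
  the SIGN of `φ_{k₀}(Δ)` (`torusN_congr_floor`, `floor_add_mul_eq_of_nonmember`, `wallDist_le`); so the reflection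
  defect vanishes off two values of `w` and the junction's symmetric part is EXACTLY `0` (`0 < η`, `ηK < 1`,
  `ηK < wallDist`): a transversal crossing of one wall is merely shifted by `δ` — its germ is odd in `δ`.
The assembly over one period and the corollary for local maximisers of `γ` are the companion file
`ConeGammaCuspSymmetricSlope`. READING (DATA of `alg/sympart.py`, in the lane's `S`-units `σ/λ₀`; not kernel):
record/41 along `e₁`: ends `+0.109`, interior multi-wall junctions `−1.249` (13 up / 38 down); `t*` along
`w = (11,−8,−4,−2,2,4,8)/11`: ends `+0.067`, interior `+0.297` (24 up / 1 down). NOT here (honest): the sign or size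
of any reflection defect, any enumeration of junction types, anything about `γ`, C2, S-E, `ζ(5)`.
-/

noncomputable section

open Set MeasureTheory
open scoped Topology

namespace Summit.KontsevichZagierPeriods.Zeta5Search.Barrier.ConeGamma

/-! ### Negated displacements; the saving near the lattice point -/

/-- The forms are odd: `φ_k(−δ) = −φ_k(δ)`. -/
theorem phiForm_neg (δ : Fin 8 → ℝ) (k : Fin 28) : phiForm (-δ) k = -phiForm δ k := by
  rw [phiForm_eq, phiForm_eq, show (-δ) = (-1 : ℝ) • δ by simp, pairForm_smul]
  ring

/-- `Y(−δ) = Y(δ)`. -/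
theorem shiftSize_neg (δ : Fin 8 → ℝ) : shiftSize (-δ) = shiftSize δ := by
  unfold shiftSize; congr 1; ext k; rw [phiForm_neg, abs_neg]

/-- `W(a,−δ) = W(a,δ)`. -/
theorem clusterWidth_neg (a : Dir) (δ : Fin 8 → ℝ) : clusterWidth a (-δ) = clusterWidth a δ := by
  unfold clusterWidth; rw [shiftSize_neg]

/-- `K(a,−δ) = K(a,δ)`. -/
theorem clusterBound_neg (a : Dir) (δ : Fin 8 → ℝ) : clusterBound a (-δ) = clusterBound a δ := by
  unfold clusterBound; rw [clusterWidth_neg, shiftSize_neg]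

/-- `W·x_max ≤ K`. -/
theorem clusterWidth_mul_xMax_le_clusterBound (a : Dir) (δ : Fin 8 → ℝ) :
    clusterWidth a δ * xMax a ≤ clusterBound a δ := by
  unfold clusterBound
  linarith [shiftSize_nonneg δ]

/-- **If all 28 integer parts `⌊φ_e(θ)⌋` are EQUAL, the saving vanishes**: `𝒩(θ) = 0` (every torus term is a sum over
`F` of differences `c − c`; generalises `torusN_eq_zero_of_floor`, the case `c = 0`). -/
theorem torusN_eq_zero_of_floor_eq {θ : Fin 8 → ℝ} {c : ℤ} (h : ∀ i j : Fin 8, i ≠ j → ⌊pairForm θ i j⌋ = c) :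
    torusN θ = 0 := by
  refine le_antisymm ?_ (torusN_nonneg θ)
  unfold torusN
  refine Finset.sup'_le _ _ fun σ _ => le_of_eq ?_
  unfold torusTerm
  refine Finset.sum_eq_zero fun k _ => ?_
  rw [phiForm_permS, phiForm_eq, h _ _ (fstIdx_ne_sndIdx k),
    h _ _ ((liftPerm σ).injective.ne (fstIdx_ne_sndIdx k)), sub_self]

/-- **Near the lattice point the unperturbed saving vanishes on BOTH sides**: for all 28 forms positive and
`|t|·x_max(a) < 1`, `𝒩(t·s(a)) = 0` — for `t ≥ 0` all 28 integer parts are `0`, for `t < 0` all are `−1`. -/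
theorem torusN_line_eq_zero_of_small {a : Dir} (hpos : ∀ k, 0 < h28 a k) {t : ℝ} (ht : |t| * xMax a < 1) :
    torusN (t • sParam a) = 0 := by
  rcases le_or_gt 0 t with h0 | h0
  · apply torusN_eq_zero_of_floor_eq (c := 0)
    intro i j hij
    obtain ⟨k, hk⟩ := exists_pairForm_sParam_eq a hij
    rw [pairForm_smul, hk, Int.floor_eq_zero_iff]
    refine ⟨mul_nonneg h0 (hpos k).le, ?_⟩
    calc t * h28 a k ≤ t * xMax a := mul_le_mul_of_nonneg_left (le_xMax a k) h0
      _ = |t| * xMax a := by rw [abs_of_nonneg h0]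
      _ < 1 := ht
  · apply torusN_eq_zero_of_floor_eq (c := -1)
    intro i j hij
    obtain ⟨k, hk⟩ := exists_pairForm_sParam_eq a hij
    rw [pairForm_smul, hk, Int.floor_eq_iff]
    push_cast
    have h1 : -t * h28 a k < 1 :=
      calc -t * h28 a k ≤ -t * xMax a := mul_le_mul_of_nonneg_left (le_xMax a k) (by linarith)
        _ = |t| * xMax a := by rw [abs_of_neg h0]
        _ < 1 := ht
    have h2 : t * h28 a k < 0 := mul_neg_of_neg_of_pos h0 (hpos k)
    constructor <;> linarith

/-! ### (A) The end germs are non-negative: the lattice point never pulls the cusp slope down -/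

/-- **The RIGHT germ at `b = 0` is `≥ 0` for EVERY displacement** (`η ≥ 0`, `η·K < 1`): on `(0, ηW]` the unperturbed
saving is `0`, so the germ integrand is `𝒩((ηw)·s(a) + ηδ) ≥ 0`. -/
theorem germR_zero_nonneg {a : Dir} (hpos : ∀ k, 0 < h28 a k) (δ : Fin 8 → ℝ) {η : ℝ} (hη : 0 ≤ η)
    (h1 : η * clusterBound a δ < 1) : 0 ≤ germR a δ η 0 := by
  unfold germR
  refine intervalIntegral.integral_nonneg (clusterWidth_pos hpos δ).le fun w hw => ?_
  unfold shiftDiff; rw [zero_add]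
  have hsmall : |η * w| * xMax a < 1 := by
    rw [abs_of_nonneg (mul_nonneg hη hw.1)]
    calc η * w * xMax a ≤ η * clusterWidth a δ * xMax a :=
          mul_le_mul_of_nonneg_right (mul_le_mul_of_nonneg_left hw.2 hη) (xMax_pos hpos).le
      _ ≤ η * clusterBound a δ := by
          rw [mul_assoc]
          exact mul_le_mul_of_nonneg_left (clusterWidth_mul_xMax_le_clusterBound a δ) hη
      _ < 1 := h1
  rw [torusN_line_eq_zero_of_small hpos hsmall, Int.cast_zero, sub_zero]
  exact_mod_cast torusN_nonneg _

/-- **The LEFT germ at `b = T` is `≥ 0` for EVERY displacement** (`T` a period of the forms, `η ≥ 0`, `η·K < 1`):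
by periodicity it is the left germ at `0` (`germL_period`), and on `[−ηW, 0)` the unperturbed saving is `0` (all 28
integer parts `−1`), so the integrand is `𝒩 ≥ 0`. Together with `germR_zero_nonneg`: the contribution of the lattice
point `u ≡ 0 (mod T)` to `cuspSlope a T δ` is `≥ 0` in EVERY direction `δ`. -/
theorem germL_period_nonneg {a : Dir} (hpos : ∀ k, 0 < h28 a k) {T : ℝ}
    (hper : ∀ k : Fin 28, ∃ z : ℤ, T * h28 a k = z) (δ : Fin 8 → ℝ) {η : ℝ} (hη : 0 ≤ η)
    (h1 : η * clusterBound a δ < 1) : 0 ≤ germL a δ η T := by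
  rw [germL_period hper]
  unfold germL
  refine intervalIntegral.integral_nonneg (by linarith [clusterWidth_pos hpos δ]) fun w hw => ?_
  unfold shiftDiff; rw [zero_add]
  have hsmall : |η * w| * xMax a < 1 := by
    rw [abs_mul, abs_of_nonneg hη]
    have hw' : |w| ≤ clusterWidth a δ := by
      rw [abs_of_nonpos hw.2]; linarith [hw.1]
    calc η * |w| * xMax a ≤ η * clusterWidth a δ * xMax a :=
          mul_le_mul_of_nonneg_right (mul_le_mul_of_nonneg_left hw' hη) (xMax_pos hpos).le
      _ ≤ η * clusterBound a δ := by
          rw [mul_assoc]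
          exact mul_le_mul_of_nonneg_left (clusterWidth_mul_xMax_le_clusterBound a δ) hη
      _ < 1 := h1
  rw [torusN_line_eq_zero_of_small hpos hsmall, Int.cast_zero, sub_zero]
  exact_mod_cast torusN_nonneg _

/-! ### (B) The reflection form of the symmetric part at one breakpoint -/

/-- The germ integrand composed with an affine map is interval integrable (measurable, bounded by `14`). -/
theorem intervalIntegrable_shiftDiff_affine (a : Dir) (δ : Fin 8 → ℝ) (η b c α β : ℝ) :
    IntervalIntegrable (fun w : ℝ => shiftDiff a δ η (b + c * w)) volume α β := by
  have haff : Measurable fun w : ℝ => b + c * w := measurable_const.add (measurable_const.mul measurable_id)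
  have hm : Measurable fun w : ℝ => shiftDiff a δ η (b + c * w) := by
    have h1 := (measurable_torusN_line a (η • δ)).comp haff
    have h2 := (measurable_torusN_line a 0).comp haff
    unfold shiftDiff
    refine Measurable.sub ?_ ?_
    · exact h1
    · simpa only [Function.comp_def, add_zero] using h2
  refine IntervalIntegrable.mono_fun' (g := fun _ => (14 : ℝ)) intervalIntegrable_const hm.aestronglyMeasurable ?_
  refine Filter.Eventually.of_forall fun w => ?_
  simp only [Real.norm_eq_abs]
  unfold shiftDiff
  have e1 := abs_torusN_le_seven ((b + c * w) • sParam a + η • δ)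
  have e2 := abs_torusN_le_seven ((b + c * w) • sParam a)
  calc |(torusN ((b + c * w) • sParam a + η • δ) : ℝ) - torusN ((b + c * w) • sParam a)|
      ≤ |(torusN ((b + c * w) • sParam a + η • δ) : ℝ)| + |(torusN ((b + c * w) • sParam a) : ℝ)| :=
        abs_sub _ _
    _ ≤ 14 := by linarith

/-- **The left germ is a right integral of the reflected displacement**: `germL a δ η b = ∫₀^W D_η(b − ηw) dw`. -/
theorem germL_eq_integral_reflect (a : Dir) (δ : Fin 8 → ℝ) (η b : ℝ) :
    germL a δ η b = ∫ w in (0 : ℝ)..clusterWidth a δ, shiftDiff a δ η (b - η * w) := by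
  unfold germL
  have h := intervalIntegral.integral_comp_neg (a := 0) (b := clusterWidth a δ)
    (f := fun w => shiftDiff a δ η (b + η * w))
  simp only [neg_zero, mul_neg, ← sub_eq_add_neg] at h
  exact h.symm

/-- **Pointwise reflection reading**: with `θ_b = b·s(a)` and `ζ = w·s(a) + δ`,
`D_η^{δ}(b + ηw) + D_η^{−δ}(b − ηw) = [𝒩(θ_b + ηζ) + 𝒩(θ_b − ηζ)] − [𝒩(θ_b + ηw·s(a)) + 𝒩(θ_b − ηw·s(a))]` — the
REFLECTION DEFECT of `𝒩` through the junction point `θ_b` at the displacement `ηζ`, measured against the line. -/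
theorem shiftDiff_add_shiftDiff_neg_reflect (a : Dir) (δ : Fin 8 → ℝ) (η b w : ℝ) :
    shiftDiff a δ η (b + η * w) + shiftDiff a (-δ) η (b - η * w) =
      ((torusN (b • sParam a + η • (w • sParam a + δ)) : ℝ) + torusN (b • sParam a - η • (w • sParam a + δ))) -
        ((torusN (b • sParam a + (η * w) • sParam a) : ℝ) + torusN (b • sParam a - (η * w) • sParam a)) := by
  unfold shiftDiff
  have e1 : (b + η * w) • sParam a + η • δ = b • sParam a + η • (w • sParam a + δ) := by
    rw [add_smul, smul_add, smul_smul]; abel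
  have e2 : (b - η * w) • sParam a + η • (-δ) = b • sParam a - η • (w • sParam a + δ) := by
    rw [sub_smul, smul_add, smul_smul, smul_neg]; abel
  have e3 : (b + η * w) • sParam a = b • sParam a + (η * w) • sParam a := add_smul _ _ _
  have e4 : (b - η * w) • sParam a = b • sParam a - (η * w) • sParam a := sub_smul _ _ _
  rw [e1, e2, e3, e4]
  ring

/-- **THE REFLECTION FORM OF THE SYMMETRIC PART AT ONE BREAKPOINT.** For every `b`, displacement `δ` and scale `η`:
`germR(δ) + germL(δ) + germR(−δ) + germL(−δ) = ∫₀^W ([D^{δ}(b+ηw) + D^{−δ}(b−ηw)] + [D^{−δ}(b+ηw) + D^{δ}(b−ηw)]) dw`,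
each bracket being a reflection defect of `𝒩` through `θ_b` (`shiftDiff_add_shiftDiff_neg_reflect`, at `ζ = w·s ± δ`).
Pure change of variables; no hypothesis on `a`, `b`, `η`. -/
theorem germ_symm_eq_integral_refl (a : Dir) (δ : Fin 8 → ℝ) (η b : ℝ) :
    germR a δ η b + germL a δ η b + germR a (-δ) η b + germL a (-δ) η b =
      ∫ w in (0 : ℝ)..clusterWidth a δ,
        ((shiftDiff a δ η (b + η * w) + shiftDiff a (-δ) η (b - η * w)) +
          (shiftDiff a (-δ) η (b + η * w) + shiftDiff a δ η (b - η * w))) := by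
  rw [germL_eq_integral_reflect, germL_eq_integral_reflect, clusterWidth_neg]
  unfold germR
  rw [clusterWidth_neg]
  have hA := intervalIntegrable_shiftDiff_affine a δ η b η 0 (clusterWidth a δ)
  have hB := intervalIntegrable_shiftDiff_affine a δ η b (-η) 0 (clusterWidth a δ)
  have hC := intervalIntegrable_shiftDiff_affine a (-δ) η b η 0 (clusterWidth a δ)
  have hD := intervalIntegrable_shiftDiff_affine a (-δ) η b (-η) 0 (clusterWidth a δ)
  simp only [neg_mul, ← sub_eq_add_neg] at hB hD
  rw [intervalIntegral.integral_add (hA.add hD) (hC.add hB), intervalIntegral.integral_add hA hD,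
    intervalIntegral.integral_add hC hB]
  ring

/-! ### (C) Single-wall breakpoints: the reflection defect vanishes, the symmetric part is `0` -/

/-- `⌊z + y⌋ = z` for `0 < y < 1`. -/
theorem floor_intCast_add_of_pos_lt_one {z : ℤ} {y : ℝ} (h0 : 0 < y) (h1 : y < 1) : ⌊(z : ℝ) + y⌋ = z := by
  rw [Int.floor_intCast_add, Int.floor_eq_zero_iff.mpr ⟨h0.le, h1⟩, add_zero]

/-- `⌊z + y⌋ = z − 1` for `−1 < y < 0`. -/
theorem floor_intCast_add_of_neg_gt_neg_one {z : ℤ} {y : ℝ} (h0 : -1 < y) (h1 : y < 0) :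
    ⌊(z : ℝ) + y⌋ = z - 1 := by
  rw [Int.floor_intCast_add]
  have : ⌊y⌋ = -1 := by
    rw [Int.floor_eq_iff]; push_cast; constructor <;> linarith
  rw [this]; ring

/-- **At a single-wall breakpoint the saving sees only the sign of the member form.** Let `b ∈ bkpts a T` with
`b·h_{k₀}(a) = z₀ ∈ ℤ` and `b·h_k(a) ∉ ℤ` for every `k ≠ k₀`. For two displacements `Δ, Δ'` whose 28 forms are `< 1`
and `< wallDist a T` in size and whose `k₀`-forms have the SAME strict sign, `𝒩(b·s(a) + Δ) = 𝒩(b·s(a) + Δ')`: the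
non-member integer parts do not move (`floor_add_mul_eq_of_nonmember`, `wallDist_le`), the member one is `z₀` or
`z₀ − 1` according to the sign (`torusN_congr_floor`). -/
theorem torusN_single_wall_eq {a : Dir} {T b : ℝ} (hb : b ∈ bkpts a T) {k₀ : Fin 28} {z₀ : ℤ}
    (hk₀ : b * h28 a k₀ = z₀) (hother : ∀ k, k ≠ k₀ → ∀ z : ℤ, b * h28 a k ≠ z) {Δ Δ' : Fin 8 → ℝ}
    (hΔ1 : ∀ k, |phiForm Δ k| < 1) (hΔ2 : ∀ k, |phiForm Δ k| < wallDist a T)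
    (hΔ'1 : ∀ k, |phiForm Δ' k| < 1) (hΔ'2 : ∀ k, |phiForm Δ' k| < wallDist a T)
    (hsign : (0 < phiForm Δ k₀ ∧ 0 < phiForm Δ' k₀) ∨ (phiForm Δ k₀ < 0 ∧ phiForm Δ' k₀ < 0)) :
    torusN (b • sParam a + Δ) = torusN (b • sParam a + Δ') := by
  refine torusN_congr_floor fun i j hij => ?_
  wlog hlt : i < j generalizing i j
  · have hji : j < i := lt_of_le_of_ne (not_lt.mp hlt) (Ne.symm hij)
    rw [pairForm_comm _ i j, pairForm_comm (b • sParam a + Δ') i j]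
    exact this j i hij.symm hji
  rw [pairForm_add, pairForm_add, pairForm_eq_phiForm_idxOf _ hlt, pairForm_eq_phiForm_idxOf _ hlt,
    pairForm_eq_phiForm_idxOf _ hlt, phiForm_smul_sParam]
  by_cases hk : idxOf i j = k₀
  · rw [hk, hk₀]
    rcases hsign with ⟨hp, hp'⟩ | ⟨hn, hn'⟩
    · rw [floor_intCast_add_of_pos_lt_one hp (abs_lt.mp (hΔ1 k₀)).2,
        floor_intCast_add_of_pos_lt_one hp' (abs_lt.mp (hΔ'1 k₀)).2]
    · rw [floor_intCast_add_of_neg_gt_neg_one (abs_lt.mp (hΔ1 k₀)).1 hn,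
        floor_intCast_add_of_neg_gt_neg_one (abs_lt.mp (hΔ'1 k₀)).1 hn']
  · have key : ∀ Δ'' : Fin 8 → ℝ, (∀ k, |phiForm Δ'' k| < wallDist a T) →
        ⌊b * h28 a (idxOf i j) + phiForm Δ'' (idxOf i j)⌋ = ⌊b * h28 a (idxOf i j)⌋ := by
      intro Δ'' hΔ''
      have h := floor_add_mul_eq_of_nonmember (x := b * h28 a (idxOf i j)) (y := phiForm Δ'' (idxOf i j))
        (fun z => (hΔ'' _).trans_le (wallDist_le hb _ (hother _ hk) z)) zero_le_one le_rfl
      rwa [one_mul] at h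
    rw [key Δ hΔ2, key Δ' hΔ'2]

/-- **The reflection defect vanishes at a single-wall breakpoint.** With `b, k₀` as in `torusN_single_wall_eq`, a
displacement `Δ` with forms `< 1`, `< wallDist` and `φ_{k₀}(Δ) ≠ 0`, and `0 < t` with `t·x_max < 1`, `t·x_max <
wallDist`: `𝒩(θ_b + Δ) + 𝒩(θ_b − Δ) = 𝒩(θ_b + t·s(a)) + 𝒩(θ_b − t·s(a))` — the pair `{θ_b ± Δ}` sees the member
wall from both sides exactly as the line does. -/
theorem refl_eq_of_single_wall {a : Dir} (hpos : ∀ k, 0 < h28 a k) {T b : ℝ} (hb : b ∈ bkpts a T) {k₀ : Fin 28}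
    {z₀ : ℤ} (hk₀ : b * h28 a k₀ = z₀) (hother : ∀ k, k ≠ k₀ → ∀ z : ℤ, b * h28 a k ≠ z) {Δ : Fin 8 → ℝ}
    (hΔ1 : ∀ k, |phiForm Δ k| < 1) (hΔ2 : ∀ k, |phiForm Δ k| < wallDist a T) (hne : phiForm Δ k₀ ≠ 0)
    {t : ℝ} (ht : 0 < t) (ht1 : t * xMax a < 1) (ht2 : t * xMax a < wallDist a T) :
    torusN (b • sParam a + Δ) + torusN (b • sParam a - Δ) =
      torusN (b • sParam a + t • sParam a) + torusN (b • sParam a - t • sParam a) := by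
  have hts : ∀ k, phiForm (t • sParam a) k = t * h28 a k := fun k => phiForm_smul_sParam t a k
  have habs_t : ∀ k, |phiForm (t • sParam a) k| = t * h28 a k := fun k => by
    rw [hts, abs_of_pos (mul_pos ht (hpos k))]
  have hle_t : ∀ k, t * h28 a k ≤ t * xMax a := fun k => mul_le_mul_of_nonneg_left (le_xMax a k) ht.le
  have hT1 : ∀ k, |phiForm (t • sParam a) k| < 1 := fun k => by rw [habs_t]; exact (hle_t k).trans_lt ht1
  have hT2 : ∀ k, |phiForm (t • sParam a) k| < wallDist a T := fun k => by
    rw [habs_t]; exact (hle_t k).trans_lt ht2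
  have hnT1 : ∀ k, |phiForm (-(t • sParam a)) k| < 1 := fun k => by rw [phiForm_neg, abs_neg]; exact hT1 k
  have hnT2 : ∀ k, |phiForm (-(t • sParam a)) k| < wallDist a T := fun k => by
    rw [phiForm_neg, abs_neg]; exact hT2 k
  have hnΔ1 : ∀ k, |phiForm (-Δ) k| < 1 := fun k => by rw [phiForm_neg, abs_neg]; exact hΔ1 k
  have hnΔ2 : ∀ k, |phiForm (-Δ) k| < wallDist a T := fun k => by rw [phiForm_neg, abs_neg]; exact hΔ2 k
  have hpos_t : 0 < phiForm (t • sParam a) k₀ := by rw [hts]; exact mul_pos ht (hpos k₀)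
  have hneg_t : phiForm (-(t • sParam a)) k₀ < 0 := by rw [phiForm_neg]; linarith
  rw [sub_eq_add_neg, sub_eq_add_neg]
  rcases lt_or_gt_of_ne hne with hn | hp
  · have hpn : 0 < phiForm (-Δ) k₀ := by rw [phiForm_neg]; linarith
    rw [torusN_single_wall_eq hb hk₀ hother hΔ1 hΔ2 hnT1 hnT2 (Or.inr ⟨hn, hneg_t⟩),
      torusN_single_wall_eq hb hk₀ hother hnΔ1 hnΔ2 hT1 hT2 (Or.inl ⟨hpn, hpos_t⟩)]
    ring
  · have hnn : phiForm (-Δ) k₀ < 0 := by rw [phiForm_neg]; linarith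
    rw [torusN_single_wall_eq hb hk₀ hother hΔ1 hΔ2 hT1 hT2 (Or.inl ⟨hp, hpos_t⟩),
      torusN_single_wall_eq hb hk₀ hother hnΔ1 hnΔ2 hnT1 hnT2 (Or.inr ⟨hnn, hneg_t⟩)]

/-- Size of the displacement `η·(w·s(a) + δ')` inside a cluster, in `phiForm` terms: `≤ η·K` for `|w| ≤ W`,
`Y(δ') ≤ Y(δ)`. -/
theorem abs_phiForm_disp_le {a : Dir} (hpos : ∀ k, 0 < h28 a k) (δ : Fin 8 → ℝ) {δ' : Fin 8 → ℝ}
    (hδ' : shiftSize δ' ≤ shiftSize δ) {w : ℝ} (hw : |w| ≤ clusterWidth a δ) {η : ℝ} (hη : 0 ≤ η) (k : Fin 28) :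
    |phiForm (η • (w • sParam a + δ')) k| ≤ η * clusterBound a δ := by
  rw [phiForm_eq]
  exact abs_pairForm_disp_le hpos δ hδ' hw hη (fstIdx_ne_sndIdx k)

/-- **SINGLE WALLS DROP OUT OF THE SYMMETRIC PART.** At a breakpoint `b ∈ bkpts a T` where exactly one form takes
an integer value, for every displacement `δ` and every scale `0 < η` with `η·K < 1` and `η·K < wallDist a T`:
`germR a δ η b + germL a δ η b + germR a (−δ) η b + germL a (−δ) η b = 0` — the reflection-form integrand vanishes
for every `w ∈ (0, W]` except where `w·h_{k₀}(a) = ∓φ_{k₀}(δ)` (two points, measure zero). -/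
theorem germ_symm_eq_zero_of_single_wall {a : Dir} (hpos : ∀ k, 0 < h28 a k) {T b : ℝ} (hb : b ∈ bkpts a T)
    {k₀ : Fin 28} (hk₀ : ∃ z : ℤ, b * h28 a k₀ = z) (hother : ∀ k, k ≠ k₀ → ∀ z : ℤ, b * h28 a k ≠ z)
    (δ : Fin 8 → ℝ) {η : ℝ} (hη : 0 < η) (h1 : η * clusterBound a δ < 1) (h2 : η * clusterBound a δ < wallDist a T) :
    germR a δ η b + germL a δ η b + germR a (-δ) η b + germL a (-δ) η b = 0 := by
  obtain ⟨z₀, hz₀⟩ := hk₀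
  rw [germ_symm_eq_integral_refl]
  have hW := clusterWidth_pos hpos δ
  have hh := hpos k₀
  -- the exceptional set
  set B : Set ℝ := {(-phiForm δ k₀) / h28 a k₀, phiForm δ k₀ / h28 a k₀} with hBdef
  have hBfin : B.Finite := by rw [hBdef]; exact (Set.finite_singleton _).insert _
  have hae : ∀ᵐ w ∂volume, w ∉ B := (measure_eq_zero_iff_ae_notMem).mp (hBfin.measure_zero volume)
  refine intervalIntegral.integral_zero_ae ?_
  filter_upwards [hae] with w hwB hwI
  rw [uIoc_of_le hW.le] at hwI
  obtain ⟨hw0, hwW⟩ := hwI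
  have hwabs : |w| ≤ clusterWidth a δ := by rw [abs_of_pos hw0]; exact hwW
  -- smallness of the four displacements and of the line step `t = ηw`
  have hY0 : shiftSize (0 : Fin 8 → ℝ) ≤ shiftSize δ := by rw [shiftSize_zero]; exact shiftSize_nonneg δ
  have hYn : shiftSize (-δ) ≤ shiftSize δ := (shiftSize_neg δ).le
  have hDp1 : ∀ k, |phiForm (η • (w • sParam a + δ)) k| < 1 := fun k =>
    (abs_phiForm_disp_le hpos δ le_rfl hwabs hη.le k).trans_lt h1
  have hDp2 : ∀ k, |phiForm (η • (w • sParam a + δ)) k| < wallDist a T := fun k =>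
    (abs_phiForm_disp_le hpos δ le_rfl hwabs hη.le k).trans_lt h2
  have hDm1 : ∀ k, |phiForm (η • (w • sParam a + -δ)) k| < 1 := fun k =>
    (abs_phiForm_disp_le hpos δ hYn hwabs hη.le k).trans_lt h1
  have hDm2 : ∀ k, |phiForm (η • (w • sParam a + -δ)) k| < wallDist a T := fun k =>
    (abs_phiForm_disp_le hpos δ hYn hwabs hη.le k).trans_lt h2
  have ht : 0 < η * w := mul_pos hη hw0
  have htx : η * w * xMax a ≤ η * clusterBound a δ := by
    calc η * w * xMax a ≤ η * clusterWidth a δ * xMax a :=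
          mul_le_mul_of_nonneg_right (mul_le_mul_of_nonneg_left hwW hη.le) (xMax_pos hpos).le
      _ ≤ η * clusterBound a δ := by
          rw [mul_assoc]; exact mul_le_mul_of_nonneg_left (clusterWidth_mul_xMax_le_clusterBound a δ) hη.le
  have ht1 : η * w * xMax a < 1 := htx.trans_lt h1
  have ht2 : η * w * xMax a < wallDist a T := htx.trans_lt h2
  -- the member form of the two displacements is non-zero off `B`
  have hform : ∀ δ' : Fin 8 → ℝ, phiForm (η • (w • sParam a + δ')) k₀ = η * (w * h28 a k₀ + phiForm δ' k₀) := by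
    intro δ'
    rw [show η • (w • sParam a + δ') = η • (w • sParam a) + η • δ' by rw [smul_add], phiForm_add, smul_smul,
      phiForm_smul_sParam, phiForm_eq (η • δ'), pairForm_smul, ← phiForm_eq]
    ring
  have hne_p : phiForm (η • (w • sParam a + δ)) k₀ ≠ 0 := by
    rw [hform]
    refine mul_ne_zero hη.ne' fun h => hwB ?_
    rw [hBdef]
    refine Or.inl ?_
    field_simp
    linarith
  have hne_m : phiForm (η • (w • sParam a + -δ)) k₀ ≠ 0 := by
    rw [hform, phiForm_neg]
    refine mul_ne_zero hη.ne' fun h => hwB ?_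
    rw [hBdef]
    refine Or.inr ?_
    show w = phiForm δ k₀ / h28 a k₀
    field_simp
    linarith
  -- both reflection defects vanish
  have r1 := shiftDiff_add_shiftDiff_neg_reflect a δ η b w
  have r2 := shiftDiff_add_shiftDiff_neg_reflect a (-δ) η b w
  rw [neg_neg] at r2
  rw [r1, r2, sub_eq_add_neg (b • sParam a) (η • (w • sParam a + δ)),
    sub_eq_add_neg (b • sParam a) (η • (w • sParam a + -δ)),
    sub_eq_add_neg (b • sParam a) ((η * w) • sParam a)]
  have e1 := refl_eq_of_single_wall hpos hb hz₀ hother hDp1 hDp2 hne_p ht ht1 ht2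
  have e2 := refl_eq_of_single_wall hpos hb hz₀ hother hDm1 hDm2 hne_m ht ht1 ht2
  rw [sub_eq_add_neg, sub_eq_add_neg] at e1 e2
  have e1' : ((torusN (b • sParam a + η • (w • sParam a + δ)) : ℝ) +
      torusN (b • sParam a + -(η • (w • sParam a + δ)))) =
      (torusN (b • sParam a + (η * w) • sParam a) : ℝ) + torusN (b • sParam a + -((η * w) • sParam a)) := by
    exact_mod_cast e1
  have e2' : ((torusN (b • sParam a + η • (w • sParam a + -δ)) : ℝ) +
      torusN (b • sParam a + -(η • (w • sParam a + -δ)))) =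
      (torusN (b • sParam a + (η * w) • sParam a) : ℝ) + torusN (b • sParam a + -((η * w) • sParam a)) := by
    exact_mod_cast e2
  rw [e1', e2']
  ring

end Summit.KontsevichZagierPeriods.Zeta5Search.Barrier.ConeGamma

end
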